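import Literature.MathematicalPhysics.KineticTheory.RiemannLocalGibbsUniqueness
import Literature.MathematicalPhysics.StatisticalMechanics.HardSphereGibbsProofs
import HarnessLib

/-!
# The hard-sphere specification: kernel measurability, properness and consistency

Topic `Literature/MathematicalPhysics/KineticTheory`; PROOFS (no definitions, no named facts),
fourth file towards the discharge of
`Literature.MathematicalPhysics.KineticTheory.RiemannLocalGibbsExistsUnique`
(`RiemannLocalGibbsLaw.lean`): the standard properties of the specification
`γ_Λ(· | η) = hsLocalSpec σ ν Λ η` (Georgii 2011, Def. 1.23 and (1.21)) that the construction of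
an infinite-volume DLR state as a limit of finite-volume Gibbs distributions uses.

* `measurable_hsLocalSpec_apply` — `η ↦ γ_Λ(A | η)` is measurable (joint measurability of gluing
  and the measurability part of Fubini);
* `hsLocalSpec_congr_boundary` — `γ_Λ(· | η)` depends on `η` only through `η|_{Λᶜ}`;
* `isProbabilityMeasure_hsLocalSpec` — `γ_Λ(· | η)` is a probability measure when `η` is hard
  core outside `Λ` and `ν(Λ × ℝ³) < ∞` (the empty configuration has positive reference
  probability);
* `hsLocalSpec_empty_ae_restrict_eq_self` — the free distribution `γ_{Λ}(· | ∅)` is carried by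
  configurations inside the window of `Λ`;
* `hsLocalSpec_preimage_restrict_le` — DOMINATION of the law of the inner configuration:
  `γ_Λ(ξ|_Δ ∈ A' | η) ≤ e^{ν(Δ × ℝ³)} P_Δ(A')`;
* **Consistency** (`lintegral_hsLocalSpec_hsLocalSpec_empty`; Georgii 2011 (1.21)
  `γ_{Λ'} γ_Λ = γ_{Λ'}` for `Λ ⊆ Λ'`, free boundary condition):
  `∫ γ_Λ(A | ζ) γ_{Λ'}(dζ | ∅) = γ_{Λ'}(A | ∅)` — Fubini over the superposition
  `P_{Λ'} = (P_Λ ⊗ P_{Λ'∖Λ}) ∘ ∪⁻¹`, the inner reference integral of the glued hard-core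
  indicator being exactly the normalisation of `γ_Λ(· | ζ)`.

## References

* H.-O. Georgii, *Gibbs Measures and Phase Transitions*, 2nd ed. (de Gruyter 2011), Def. 1.23,
  (1.21) (consistency of a specification). [Georgii2011]
* M. Michelen, W. Perkins, arXiv:2109.01094, §3.1–3.2. [MichelenPerkins2021]
-/

noncomputable section

open MeasureTheory ProbabilityTheory Set Filter
open scoped ENNReal NNReal Topology

namespace Literature.MathematicalPhysics.KineticTheory

open Literature.Analysis.FunctionSpaces
open Literature.MathematicalPhysics.StatisticalMechanics
open Literature.MathematicalPhysics.StatisticalMechanics.HardSphere (Pos Phase window hardCoreSet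
  glue poissonLaw IsHardCore)

/-! ### Elementary algebra of gluing -/

/-- The empty configuration has no points. [folklore] -/
@[simp] theorem notMem_empty' (x : Phase) : x ∉ (∅ : PointConfig Phase) := by
  change x ∉ (∅ : PointConfig Phase).carrier; simp

/-- Superposition with the empty configuration. [folklore] -/
@[simp] theorem union_empty' (c : PointConfig Phase) : c ∪ (∅ : PointConfig Phase) = c :=
  PointConfig.ext fun x => by simp [PointConfig.mem_union]

/-- Superposition with the empty configuration on the left. [folklore] -/
@[simp] theorem empty_union' (c : PointConfig Phase) : (∅ : PointConfig Phase) ∪ c = c :=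
  PointConfig.ext fun x => by simp [PointConfig.mem_union]

/-- The empty configuration restricts to itself. [folklore] -/
@[simp] theorem restrict_empty' (s : Set Phase) : (∅ : PointConfig Phase).restrict s = ∅ :=
  PointConfig.ext fun x => by simp [mem_restrict_iff]

/-- Restriction distributes over superposition. [folklore] -/
theorem restrict_union' (s : Set Phase) (c d : PointConfig Phase) :
    (c ∪ d).restrict s = c.restrict s ∪ d.restrict s :=
  PointConfig.ext fun x => by
    simp only [mem_restrict_iff, PointConfig.mem_union]
    tauto

/-- A configuration carried by `s` has empty restriction to `sᶜ`. [folklore] -/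
theorem restrict_compl_eq_empty_of_restrict_eq {s : Set Phase} {c : PointConfig Phase}
    (h : c.restrict s = c) : c.restrict sᶜ = ∅ :=
  PointConfig.ext fun x => by
    simp only [mem_restrict_iff, mem_compl_iff]
    constructor
    · rintro ⟨hx, hxs⟩
      rw [← h] at hx
      exact absurd hx.2 hxs
    · intro hx
      exact absurd hx (by change x ∉ (∅ : PointConfig Phase).carrier; simp)

/-- A configuration is carried by `s` iff it has no point outside `s`. [folklore] -/
theorem restrict_eq_self_iff_count_compl_eq_zero {s : Set Phase} {c : PointConfig Phase} :
    c.restrict s = c ↔ c.count sᶜ = 0 := by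
  rw [count_eq_zero_iff']
  constructor
  · intro h x hx hxs
    rw [← h] at hx
    exact hxs hx.2
  · intro h
    exact PointConfig.ext fun x => ⟨fun hx => hx.1, fun hx => ⟨hx, not_notMem.1 (h x hx)⟩⟩

/-- The event "carried by `s`" is measurable. [folklore] -/
theorem measurableSet_restrict_eq_self {s : Set Phase} (hs : MeasurableSet s) :
    MeasurableSet {c : PointConfig Phase | c.restrict s = c} := by
  simp_rw [restrict_eq_self_iff_count_compl_eq_zero]
  exact measurableSet_count_eq_zero hs.compl

/-- Gluing with the free boundary condition is restriction to the window. [folklore] -/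
theorem glue_empty (Λ : Set Pos) (ξ : PointConfig Phase) : glue Λ ∅ ξ = ξ.restrict (window Λ) := by
  rw [glue, restrict_empty', union_empty']

/-- **The specification depends on the boundary condition only outside `Λ`.** [folklore] -/
theorem glue_congr_boundary {Λ : Set Pos} {η η' : PointConfig Phase}
    (h : η.restrict (window Λ)ᶜ = η'.restrict (window Λ)ᶜ) : glue Λ η = glue Λ η' := by
  funext ξ; rw [glue, glue, h]

/-- **`γ_Λ(· | η)` depends on `η` only through `η|_{Λᶜ}`** (Georgii 2011, Def. 1.23 (ii)).
[cite: Georgii2011, Def. 1.23] -/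
theorem hsLocalSpec_congr_boundary (σ : ℝ) (ν : Measure Phase) {Λ : Set Pos}
    {η η' : PointConfig Phase} (h : η.restrict (window Λ)ᶜ = η'.restrict (window Λ)ᶜ) :
    hsLocalSpec σ ν Λ η = hsLocalSpec σ ν Λ η' := by
  rw [hsLocalSpec_def, hsLocalSpec_def, glue_congr_boundary h]

/-- Gluing an inner configuration to a boundary configuration carried by the outside is
superposition. [folklore] -/
theorem glue_eq_union_of_restrict {Λ : Set Pos} {ω ξ : PointConfig Phase}
    (hω : ω.restrict (window Λ)ᶜ = ω) (hξ : ξ.restrict (window Λ) = ξ) : glue Λ ω ξ = ξ ∪ ω := by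
  rw [glue, hω, hξ]

/-! ### The specification as a kernel -/

section Kernel

variable (ν : Measure Phase) {σ : ℝ}

/-- **The specification in terms of the reference law**: for measurable `A`,
`γ_Λ(A | η) = P_Λ{glue ∈ hard core}⁻¹ · P_Λ{glue ∈ A ∩ hard core}`. [folklore] -/
theorem hsLocalSpec_apply_eq (σ : ℝ) {Λ : Set Pos} (hΛ : MeasurableSet Λ) (η : PointConfig Phase)
    {A : Set (PointConfig Phase)} (hA : MeasurableSet A) :
    hsLocalSpec σ ν Λ η A =
      (poissonLaw (ν.restrict (window Λ)) (glue Λ η ⁻¹' hardCoreSet σ))⁻¹ *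
        poissonLaw (ν.restrict (window Λ)) (glue Λ η ⁻¹' (A ∩ hardCoreSet σ)) := by
  have hH := HardSphere.measurableSet_hardCoreSet σ
  have hg := HardSphere.measurable_glue hΛ η
  rw [hsLocalSpec_def, Measure.smul_apply, smul_eq_mul, Measure.restrict_apply hA,
    Measure.restrict_apply MeasurableSet.univ, univ_inter, Measure.map_apply hg (hA.inter hH),
    Measure.map_apply hg hH]

/-- `poissonLaw m` is always a probability measure (a Poisson law in the honest branch, the
point mass at `∅` in the junk branch). [folklore] -/
theorem isProbabilityMeasure_poissonLaw (m : Measure Phase) : IsProbabilityMeasure (poissonLaw m) := by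
  unfold poissonLaw
  split_ifs with h
  · exact (Classical.choose_spec (HardSphere.exists_isPoissonPointProcess m h)).isProbabilityMeasure
  · infer_instance

/-- The glued reference probability of an event is measurable in the boundary condition.
[folklore] -/
theorem measurable_measure_glue_preimage {Λ : Set Pos} (hΛ : MeasurableSet Λ)
    {B : Set (PointConfig Phase)} (hB : MeasurableSet B) :
    Measurable fun η : PointConfig Phase => poissonLaw (ν.restrict (window Λ)) (glue Λ η ⁻¹' B) := by
  haveI := isProbabilityMeasure_poissonLaw (ν.restrict (window Λ))
  exact measurable_measure_prodMk_left (ν := poissonLaw (ν.restrict (window Λ)))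
    (hB.preimage (HardSphere.measurable_glue_uncurry hΛ))

/-- **The specification is a measurable kernel in the boundary condition**: `η ↦ γ_Λ(A | η)` is
measurable (Georgii 2011, Def. 1.23 (ii)). [cite: Georgii2011, Def. 1.23] -/
theorem measurable_hsLocalSpec_apply (σ : ℝ) {Λ : Set Pos} (hΛ : MeasurableSet Λ)
    {A : Set (PointConfig Phase)} (hA : MeasurableSet A) :
    Measurable fun η : PointConfig Phase => hsLocalSpec σ ν Λ η A := by
  have hH := HardSphere.measurableSet_hardCoreSet σ
  simp_rw [hsLocalSpec_apply_eq ν σ hΛ _ hA]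
  exact (measurable_measure_glue_preimage ν hΛ hH).inv.mul
    (measurable_measure_glue_preimage ν hΛ (hA.inter hH))

/-- **Properness / positivity of the normalisation**: if the boundary condition is hard core
outside `Λ`, the reference probability that the glued configuration is hard core is at least the
void probability `e^{-ν(Λ × ℝ³)}` (glue the empty configuration). [cite: Georgii2011, Def. 1.23] -/
theorem exp_le_measure_glue_preimage_hardCoreSet [IsLocallyFiniteMeasure ν] (h0 : ∀ x, ν {x} = 0) {Λ : Set Pos}
    (hfin : ν (window Λ) ≠ ∞) {η : PointConfig Phase}
    (hη : IsHardCore σ (η.restrict (window Λ)ᶜ)) :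
    ENNReal.ofReal (Real.exp (-(ν (window Λ)).toReal)) ≤
      poissonLaw (ν.restrict (window Λ)) (glue Λ η ⁻¹' hardCoreSet σ) := by
  have hP := isPoissonPointProcess_poissonLaw_restrict' ν h0 (window Λ)
  haveI : IsFiniteMeasure (ν.restrict (window Λ)) :=
    ⟨by rw [Measure.restrict_apply_univ]; exact hfin.lt_top⟩
  rw [← Measure.restrict_apply_univ (s := window Λ) (μ := ν), ← measure_count_univ_eq_zero hP]
  refine measure_mono fun ξ hξ => ?_
  have h := eq_empty_of_count_univ_eq_zero hξ
  subst h
  change IsHardCore σ (glue Λ η ∅)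
  rw [glue, restrict_empty', empty_union']
  exact hη

/-- **The specification is a probability measure** for a boundary condition hard core outside `Λ`
when `ν(Λ × ℝ³) < ∞` (Georgii 2011, Def. 1.23 (i)). [cite: Georgii2011, Def. 1.23] -/
theorem isProbabilityMeasure_hsLocalSpec [IsLocallyFiniteMeasure ν] (h0 : ∀ x, ν {x} = 0) {Λ : Set Pos} (hΛ : MeasurableSet Λ)
    (hfin : ν (window Λ) ≠ ∞) {η : PointConfig Phase}
    (hη : IsHardCore σ (η.restrict (window Λ)ᶜ)) : IsProbabilityMeasure (hsLocalSpec σ ν Λ η) := by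
  haveI := isProbabilityMeasure_poissonLaw (ν.restrict (window Λ))
  have hne : poissonLaw (ν.restrict (window Λ)) (glue Λ η ⁻¹' hardCoreSet σ) ≠ 0 :=
    ne_of_gt (lt_of_lt_of_le (ENNReal.ofReal_pos.2 (Real.exp_pos _))
      (exp_le_measure_glue_preimage_hardCoreSet ν h0 hfin hη))
  refine ⟨?_⟩
  rw [hsLocalSpec_apply_eq ν σ hΛ η MeasurableSet.univ, univ_inter,
    ENNReal.inv_mul_cancel hne (measure_ne_top _ _)]

/-- **The free finite-volume distribution is carried by configurations inside the window**:
`γ_Λ(· | ∅)`-a.s. `ζ|_{Λ × ℝ³} = ζ`. [folklore] -/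
theorem hsLocalSpec_empty_ae_restrict_eq_self (σ : ℝ) {Λ : Set Pos} (hΛ : MeasurableSet Λ) :
    ∀ᵐ ζ ∂(hsLocalSpec σ ν Λ ∅), ζ.restrict (window Λ) = ζ := by
  have hE := measurableSet_restrict_eq_self (HardSphere.measurableSet_window hΛ) (s := window Λ)
  rw [ae_iff, show {ζ : PointConfig Phase | ¬ζ.restrict (window Λ) = ζ} =
      {ζ : PointConfig Phase | ζ.restrict (window Λ) = ζ}ᶜ from rfl,
    hsLocalSpec_apply_eq ν σ hΛ ∅ hE.compl]
  have : glue Λ (∅ : PointConfig Phase) ⁻¹'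
      ({ζ : PointConfig Phase | ζ.restrict (window Λ) = ζ}ᶜ ∩ hardCoreSet σ) = ∅ := by
    refine eq_empty_of_forall_notMem fun ξ hξ => hξ.1 ?_
    change (glue Λ ∅ ξ).restrict (window Λ) = glue Λ ∅ ξ
    rw [glue_empty, restrict_restrict_of_subset subset_rfl]
  rw [this, measure_empty, mul_zero]

/-- **The free finite-volume distribution is carried by hard-core configurations.** [folklore] -/
theorem hsLocalSpec_ae_isHardCore (σ : ℝ) (Λ : Set Pos) (η : PointConfig Phase) :
    ∀ᵐ ζ ∂(hsLocalSpec σ ν Λ η), IsHardCore σ ζ := by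
  rw [ae_iff]
  exact hsLocalSpec_apply_compl_hardCoreSet σ ν Λ η

/-- **Domination of the inner marginal by the reference law**: for `Δ ⊆ Λ`, a boundary
condition `η` hard core outside `Λ`, and measurable `A'`,
`γ_Λ(ξ|_Δ ∈ A' | η) ≤ e^{ν(Δ × ℝ³)} P_Δ(A')` — in the ratio formula
`hsLocalSpec_apply_preimage_restrict` the numerator integrand is at most `Z_{Λ∖Δ}(F(η))` and the
denominator is at least the contribution `e^{-ν(Δ × ℝ³)} Z_{Λ∖Δ}(F(η))` of the empty inner
configuration. [cite: MichelenPerkins2021, §3.2, Lemma 14] -/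
theorem hsLocalSpec_preimage_restrict_le [IsLocallyFiniteMeasure ν] (h0 : ∀ x, ν {x} = 0) {Λ Δ : Set Pos}
    (hΛ : MeasurableSet Λ) (hΔ : MeasurableSet Δ) (hΔΛ : Δ ⊆ Λ) (hfin : ν (window Λ) ≠ ∞)
    {η : PointConfig Phase} (hη : IsHardCore σ (η.restrict (window Λ)ᶜ))
    {A' : Set (PointConfig Phase)} (hA' : MeasurableSet A') :
    hsLocalSpec σ ν Λ η (PointConfig.restrict (window Δ) ⁻¹' A') ≤
      ENNReal.ofReal (Real.exp (ν (window Δ)).toReal) *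
        poissonLaw (ν.restrict (window Δ)) A' := by
  set PΔ := poissonLaw (ν.restrict (window Δ)) with hPΔ
  set PV := poissonLaw (ν.restrict (window (Λ \ Δ))) with hPV
  set ηo := η.restrict (window Λ)ᶜ with hηo
  set Fη : Set Phase := ⋃ x ∈ (ηo : Set Phase), window (Metric.ball x.1 σ) with hFη
  have hPΔ' := isPoissonPointProcess_poissonLaw_restrict' ν h0 (window Δ)
  have hPV' := isPoissonPointProcess_poissonLaw_restrict' ν h0 (window (Λ \ Δ))
  haveI := hPΔ'.isProbabilityMeasure
  haveI := hPV'.isProbabilityMeasure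
  have hνΔ : ν (window Δ) ≠ ∞ := ne_top_of_le_ne_top hfin (measure_mono (window_mono hΔΛ))
  have hνV : ν (window (Λ \ Δ)) ≠ ∞ :=
    ne_top_of_le_ne_top hfin (measure_mono (window_mono sdiff_subset))
  haveI : IsFiniteMeasure (ν.restrict (window Δ)) :=
    ⟨by rw [Measure.restrict_apply_univ]; exact hνΔ.lt_top⟩
  haveI : IsFiniteMeasure (ν.restrict (window (Λ \ Δ))) :=
    ⟨by rw [Measure.restrict_apply_univ]; exact hνV.lt_top⟩
  set φ : PointConfig Phase → ℝ≥0∞ := fun ξ =>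
    (hardCoreSet σ).indicator (1 : PointConfig Phase → ℝ≥0∞) (ξ ∪ ηo) *
      PV (hardCoreSet σ ∩ {ζ : PointConfig Phase |
        ζ.count (Fη ∪ ⋃ x ∈ (ξ : Set Phase), window (Metric.ball x.1 σ)) = 0}) with hφ
  -- numerator: `φ ≤ Z_V(F(η))`
  have hnum : ∫⁻ ξ in A', φ ξ ∂PΔ ≤ PV (hardCoreSet σ ∩ {ζ | ζ.count Fη = 0}) * PΔ A' := by
    calc ∫⁻ ξ in A', φ ξ ∂PΔ ≤ ∫⁻ _ in A', PV (hardCoreSet σ ∩ {ζ | ζ.count Fη = 0}) ∂PΔ := by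
          refine lintegral_mono fun ξ => ?_
          simp only [hφ]
          refine (mul_le_of_le_one_left' ?_).trans (measure_mono fun ζ hζ => ⟨hζ.1, ?_⟩)
          · by_cases h : ξ ∪ ηo ∈ hardCoreSet σ
            · rw [indicator_of_mem h, Pi.one_apply]
            · rw [indicator_of_notMem h]; exact zero_le_one
          · exact (count_union_eq_zero_iff.1 hζ.2).1
      _ = PV (hardCoreSet σ ∩ {ζ | ζ.count Fη = 0}) * PΔ A' := by
          rw [setLIntegral_const]
  -- denominator: the empty inner configuration contributes `e^{-ν(Δ × ℝ³)} Z_V(F(η))`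
  have hden : ENNReal.ofReal (Real.exp (-(ν (window Δ)).toReal)) *
      PV (hardCoreSet σ ∩ {ζ | ζ.count Fη = 0}) ≤ ∫⁻ ξ, φ ξ ∂PΔ := by
    have hvoid : PΔ {ξ : PointConfig Phase | ξ.count univ = 0} =
        ENNReal.ofReal (Real.exp (-(ν (window Δ)).toReal)) := by
      rw [measure_count_univ_eq_zero hPΔ', Measure.restrict_apply_univ]
    rw [← hvoid, ← lintegral_indicator_one (measurableSet_count_eq_zero MeasurableSet.univ),
      ← lintegral_mul_const _ (measurable_one.indicator (measurableSet_count_eq_zero MeasurableSet.univ))]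
    refine lintegral_mono fun ξ => ?_
    by_cases hξ : ξ ∈ {ξ : PointConfig Phase | ξ.count univ = 0}
    · have hξe : ξ = ∅ := eq_empty_of_count_univ_eq_zero hξ
      subst hξe
      rw [indicator_of_mem hξ, Pi.one_apply, one_mul]
      simp only [hφ, empty_union', indicator_of_mem (show ηo ∈ hardCoreSet σ from hη), Pi.one_apply,
        one_mul]
      refine measure_mono fun ζ hζ => ⟨hζ.1, ?_⟩
      have h2 : ζ.count Fη = 0 := hζ.2
      change ζ.count (Fη ∪ ⋃ x ∈ ((∅ : PointConfig Phase) : Set Phase), window (Metric.ball x.1 σ)) = 0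
      rwa [show ((∅ : PointConfig Phase) : Set Phase) = ∅ from rfl, biUnion_empty, union_empty]
    · rw [indicator_of_notMem hξ, zero_mul]; exact bot_le
  have hZpos : PV (hardCoreSet σ ∩ {ζ | ζ.count Fη = 0}) ≠ 0 :=
    ne_of_gt (lt_of_lt_of_le (ENNReal.ofReal_pos.2 (Real.exp_pos _))
      (exp_le_measure_hardCore_void hPV' σ Fη))
  have hZtop : PV (hardCoreSet σ ∩ {ζ | ζ.count Fη = 0}) ≠ ∞ := measure_ne_top _ _
  have hepos : ENNReal.ofReal (Real.exp (-(ν (window Δ)).toReal)) ≠ 0 :=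
    ne_of_gt (ENNReal.ofReal_pos.2 (Real.exp_pos _))
  rw [hsLocalSpec_apply_preimage_restrict ν h0 hΛ hΔ hΔΛ η hA']
  change (∫⁻ ξ, φ ξ ∂PΔ)⁻¹ * ∫⁻ ξ in A', φ ξ ∂PΔ ≤ _
  calc (∫⁻ ξ, φ ξ ∂PΔ)⁻¹ * ∫⁻ ξ in A', φ ξ ∂PΔ
      ≤ (ENNReal.ofReal (Real.exp (-(ν (window Δ)).toReal)) *
          PV (hardCoreSet σ ∩ {ζ | ζ.count Fη = 0}))⁻¹ *
        (PV (hardCoreSet σ ∩ {ζ | ζ.count Fη = 0}) * PΔ A') := by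
        gcongr
    _ = ENNReal.ofReal (Real.exp (ν (window Δ)).toReal) * PΔ A' := by
        rw [ENNReal.mul_inv (Or.inl hepos) (Or.inl ENNReal.ofReal_ne_top), mul_assoc,
          ← mul_assoc (PV _)⁻¹, ENNReal.inv_mul_cancel hZpos hZtop, one_mul, ← ENNReal.ofReal_inv_of_pos
          (Real.exp_pos _), Real.exp_neg, inv_inv]

end Kernel

/-! ### Consistency with the free boundary condition -/

section Consistency

variable (ν : Measure Phase) [IsLocallyFiniteMeasure ν] {σ : ℝ}

/-- **Consistency of the hard-sphere specification, free boundary condition** (Georgii 2011,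
(1.21): `γ_{Λ'} γ_Λ = γ_{Λ'}` for `Λ ⊆ Λ'`): averaging the distribution in `Λ` with boundary
condition `ζ` over `ζ` drawn from the free distribution in `Λ' ⊇ Λ` returns the free distribution
in `Λ'`.  Proof: `γ_{Λ'}(· | ∅)` is `P_{Λ'}` conditioned on the hard core; writing a sample of
`P_{Λ'}` as the superposition `ξ ∪ ω` of independent samples of `P_Λ` and `P_{Λ'∖Λ}`, the kernel
`γ_Λ(· | ξ ∪ ω) = γ_Λ(· | ω)` does not see `ξ`, and integrating the hard-core indicator of `ξ ∪ ω`
over `ξ` produces exactly the normalisation `P_Λ{glue_Λ(ω, ·) hard core}` of `γ_Λ(· | ω)`, which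
cancels (Fubini). [cite: Georgii2011, Def. 1.23] -/
theorem lintegral_hsLocalSpec_hsLocalSpec_empty (h0 : ∀ x, ν {x} = 0) {Λ Λ' : Set Pos}
    (hΛ : MeasurableSet Λ) (hΛ' : MeasurableSet Λ') (hΛΛ' : Λ ⊆ Λ')
    {A : Set (PointConfig Phase)} (hA : MeasurableSet A) :
    ∫⁻ ζ, hsLocalSpec σ ν Λ ζ A ∂(hsLocalSpec σ ν Λ' ∅) = hsLocalSpec σ ν Λ' ∅ A := by
  classical
  set P' := poissonLaw (ν.restrict (window Λ')) with hP'
  set PΛ := poissonLaw (ν.restrict (window Λ)) with hPΛ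
  set PW := poissonLaw (ν.restrict (window (Λ' \ Λ))) with hPW
  have hwΛ : MeasurableSet (window Λ) := HardSphere.measurableSet_window hΛ
  have hwΛ' : MeasurableSet (window Λ') := HardSphere.measurableSet_window hΛ'
  have hwW : MeasurableSet (window (Λ' \ Λ)) := HardSphere.measurableSet_window (hΛ'.diff hΛ)
  haveI := isProbabilityMeasure_poissonLaw (ν.restrict (window Λ'))
  haveI := isProbabilityMeasure_poissonLaw (ν.restrict (window Λ))
  haveI := isProbabilityMeasure_poissonLaw (ν.restrict (window (Λ' \ Λ)))
  have hH := HardSphere.measurableSet_hardCoreSet σ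
  have hu : Measurable fun p : PointConfig Phase × PointConfig Phase => p.1 ∪ p.2 :=
    PointConfig.measurable_union'
  -- Step 1: the free distribution in `Λ'` is `P'` conditioned on the hard core
  have hmap : P'.map (glue Λ' ∅) = P' := by
    rw [Measure.map_congr (show glue Λ' (∅ : PointConfig Phase) =ᵐ[P'] id from ?_), Measure.map_id]
    filter_upwards [ae_restrict_eq_self ν h0 hwΛ'] with ξ hξ
    rw [glue_empty, hξ, id]
  have hQm : hsLocalSpec σ ν Λ' ∅ = (P' (hardCoreSet σ))⁻¹ • P'.restrict (hardCoreSet σ) := by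
    rw [hsLocalSpec_def, ← hP', hmap, Measure.restrict_apply_univ]
  -- Step 2: reduce to an identity between `P'`-integrals
  rw [hQm, lintegral_smul_measure, smul_eq_mul, Measure.smul_apply, smul_eq_mul,
    Measure.restrict_apply hA]
  congr 1
  set F : PointConfig Phase → ℝ≥0∞ := fun ζ =>
    (hardCoreSet σ).indicator (fun ζ => hsLocalSpec σ ν Λ ζ A) ζ with hF
  have hFm : Measurable F := (measurable_hsLocalSpec_apply ν σ hΛ hA).indicator hH
  rw [← lintegral_indicator hH, ← lintegral_indicator_one (hA.inter hH)]
  change ∫⁻ ζ, F ζ ∂P' = ∫⁻ ζ, (A ∩ hardCoreSet σ).indicator 1 ζ ∂P'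
  -- Step 3: superposition `P' = (P_Λ ⊗ P_W) ∘ ∪⁻¹` and Tonelli
  rw [hP', poissonLaw_window_eq_map_prod ν h0 hΛ' hΛ hΛΛ', lintegral_map hFm hu,
    lintegral_map (measurable_one.indicator (hA.inter hH)) hu,
    lintegral_prod_symm (fun p : PointConfig Phase × PointConfig Phase => F (p.1 ∪ p.2))
      (hFm.comp hu).aemeasurable,
    lintegral_prod_symm (fun p : PointConfig Phase × PointConfig Phase =>
      (A ∩ hardCoreSet σ).indicator (1 : PointConfig Phase → ℝ≥0∞) (p.1 ∪ p.2))
      ((measurable_one.indicator (hA.inter hH)).comp hu).aemeasurable]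
  refine lintegral_congr_ae ?_
  filter_upwards [ae_restrict_eq_self ν h0 hwW] with ω hω
  -- `ω` lives outside `Λ`
  have hωc : ω.restrict (window Λ)ᶜ = ω := by
    refine PointConfig.ext fun x => ⟨fun hx => hx.1, fun hx => ⟨hx, ?_⟩⟩
    rw [← hω] at hx
    have h2 : x ∈ window (Λ' \ Λ) := hx.2
    rw [window_diff] at h2
    exact h2.2
  set gω := glue Λ ω with hgω
  have hgm : Measurable gω := HardSphere.measurable_glue hΛ ω
  -- the normalisation cancels
  have hcancel : PΛ (gω ⁻¹' hardCoreSet σ) * hsLocalSpec σ ν Λ ω A =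
      PΛ (gω ⁻¹' (A ∩ hardCoreSet σ)) := by
    rw [hsLocalSpec_apply_eq ν σ hΛ ω hA]
    by_cases hz : PΛ (gω ⁻¹' hardCoreSet σ) = 0
    · have : PΛ (gω ⁻¹' (A ∩ hardCoreSet σ)) = 0 :=
        measure_mono_null (preimage_mono inter_subset_right) hz
      change PΛ (gω ⁻¹' hardCoreSet σ) * ((PΛ (gω ⁻¹' hardCoreSet σ))⁻¹ *
        PΛ (gω ⁻¹' (A ∩ hardCoreSet σ))) = PΛ (gω ⁻¹' (A ∩ hardCoreSet σ))
      rw [this, mul_zero, mul_zero]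
    · change PΛ (gω ⁻¹' hardCoreSet σ) * ((PΛ (gω ⁻¹' hardCoreSet σ))⁻¹ *
        PΛ (gω ⁻¹' (A ∩ hardCoreSet σ))) = PΛ (gω ⁻¹' (A ∩ hardCoreSet σ))
      rw [← mul_assoc, ENNReal.mul_inv_cancel hz (measure_ne_top _ _), one_mul]
  -- the inner integral on the left
  have hL : ∫⁻ ξ, F (ξ ∪ ω) ∂PΛ = PΛ (gω ⁻¹' hardCoreSet σ) * hsLocalSpec σ ν Λ ω A := by
    rw [← lintegral_indicator_one (hH.preimage hgm),
      ← lintegral_mul_const _ (measurable_one.indicator (hH.preimage hgm))]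
    refine lintegral_congr_ae ?_
    filter_upwards [ae_restrict_eq_self ν h0 hwΛ] with ξ hξ
    have hglue : gω ξ = ξ ∪ ω := glue_eq_union_of_restrict hωc hξ
    have hbd : (ξ ∪ ω).restrict (window Λ)ᶜ = ω.restrict (window Λ)ᶜ := by
      rw [restrict_union', restrict_compl_eq_empty_of_restrict_eq hξ, empty_union']
    simp only [hF]
    by_cases h : ξ ∪ ω ∈ hardCoreSet σ
    · rw [indicator_of_mem h, indicator_of_mem (show ξ ∈ gω ⁻¹' hardCoreSet σ by
        rw [mem_preimage, hglue]; exact h), Pi.one_apply, one_mul]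
      change hsLocalSpec σ ν Λ (ξ ∪ ω) A = hsLocalSpec σ ν Λ ω A
      rw [hsLocalSpec_congr_boundary σ ν hbd]
    · rw [indicator_of_notMem h, indicator_of_notMem (show ξ ∉ gω ⁻¹' hardCoreSet σ by
        rw [mem_preimage, hglue]; exact h), zero_mul]
  -- the inner integral on the right
  have hR : ∫⁻ ξ, (A ∩ hardCoreSet σ).indicator (1 : PointConfig Phase → ℝ≥0∞) (ξ ∪ ω) ∂PΛ =
      PΛ (gω ⁻¹' (A ∩ hardCoreSet σ)) := by
    rw [← lintegral_indicator_one ((hA.inter hH).preimage hgm)]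
    refine lintegral_congr_ae ?_
    filter_upwards [ae_restrict_eq_self ν h0 hwΛ] with ξ hξ
    have hglue : gω ξ = ξ ∪ ω := glue_eq_union_of_restrict hωc hξ
    by_cases h : ξ ∪ ω ∈ A ∩ hardCoreSet σ
    · rw [indicator_of_mem h, indicator_of_mem (show ξ ∈ gω ⁻¹' (A ∩ hardCoreSet σ) by
        rw [mem_preimage, hglue]; exact h), Pi.one_apply, Pi.one_apply]
    · rw [indicator_of_notMem h, indicator_of_notMem (show ξ ∉ gω ⁻¹' (A ∩ hardCoreSet σ) by
        rw [mem_preimage, hglue]; exact h)]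
  change ∫⁻ ξ, F (ξ ∪ ω) ∂PΛ = ∫⁻ ξ, (A ∩ hardCoreSet σ).indicator 1 (ξ ∪ ω) ∂PΛ
  rw [hL, hR, hcancel]

/-- **Consistency along the balls**: for `n ≤ n'` and measurable `A`,
`∫ γ_{B(0,n)}(A | ζ) γ_{B(0,n')}(dζ | ∅) = γ_{B(0,n')}(A | ∅)`. [cite: Georgii2011, Def. 1.23] -/
theorem lintegral_hsLocalSpec_ball_hsLocalSpec_ball_empty (h0 : ∀ x, ν {x} = 0) {n n' : ℝ}
    (hnn' : n ≤ n') {A : Set (PointConfig Phase)} (hA : MeasurableSet A) :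
    ∫⁻ ζ, hsLocalSpec σ ν (Metric.ball 0 n) ζ A ∂(hsLocalSpec σ ν (Metric.ball 0 n') ∅) =
      hsLocalSpec σ ν (Metric.ball 0 n') ∅ A :=
  lintegral_hsLocalSpec_hsLocalSpec_empty ν h0 Metric.isOpen_ball.measurableSet
    Metric.isOpen_ball.measurableSet (Metric.ball_subset_ball hnn') hA

end Consistency

end Literature.MathematicalPhysics.KineticTheory

end
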